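import Summits.ABC.ABC.Theses.FeketeScales
import Summits.ABC.ABC.Theorems.FeketeScalesSubmultOfRST
import Summits.ABC.ABC.Theorems.FeketeScalesSubmultOfRSTBridge
import Summits.ABC.ABC.Theorems.FeketeScalesScaleSubmultiplicativityOfEnvelopeOfPowerShapes
import Summits.ABC.ABC.Theorems.FeketeScalesTargetOfSubPowerSlack

/-!
# Crux-strategist companion — `ScaleSubmultiplicativity` (stmt-ABC-2160), STRATEGY-CENSUS.md

Seat planner-cstrat-stmt-ABC-2160-p1-0 (wall-breaker on an exhausted chain, 2026-08-17).
This file TYPES the objects the census argues about and kernel-checks the cheap implications; it proves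
nothing of the crux.  Sections follow the census headings.

* §T Transfer — the function-field sibling proves sub-additivity of its extremal degree by
  (pointwise Mason–Stothers) + (universal witnesses); over `ℕ` that two-step argument is EXACTLY the landed
  support item `submultOfRST_proof` (pointwise sub-power slack + dyadic witnesses ⟹ crux), and its pointwise
  input is summit-strength (`Target.abc_of_subPowerSlack`).  Certificates below.
* §S Strengthen — the candidate rigid forms S⁺ as Props: `SubPower`, `RateABC`, `MonotoneRecordQuality`,
  `ProportionalShadows` (each discussed in the census; none proved, none claimed).
* §D Decomposition — a generic regime-split combinator `scaleSubmultiplicativity_of_split` (crux on a regime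
  `Q` ∧ crux on `¬Q` ⟹ crux, via the landed `ScaleSubmultiplicativity.bound_mono`), and two NEW typed splits:
  D4 depth-in-scale (`QuadraticDepthSubmult` ∧ `ShallowSubmult`; the deep half follows from abc with the fixed
  exponent 2, `quadraticDepthSubmult_of_fixedExponentTwo`), D5 split-shape (`BalancedSubmult` ∧ `LopsidedSubmult`).
* §N Negation — `not_shadowed_of_poor`: what a refutation must certify at one split (poverty of BOTH scales =
  good-scale certification, plus a beating triple).

All over tree vocabulary (`IsABCTriple`, `rad`, the route decls); Mathlib only otherwise.
-/

-- `Summit.<Summit>.<Problem>` is the mandated summit-side namespace (CONVENTIONS §2).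
set_option linter.dupNamespace false

namespace Summit.ABC.ABC.Cruxes.ScaleSubmultiplicativity.Strategist

open Literature.NumberTheory.DiophantineGeometry
open Summit.ABC.ABC.Theses.FeketeScales
open Summit.ABC.ABC.Theorems

/-! ## Common vocabulary -/

/-- The crux's G-free inequality at ONE split `(R₁, R₂)` for ONE triple, with parameters `(θ, K)`:
shadows exist. -/
def Shadowed (θ K : ℝ) (R₁ R₂ _a _b c : ℕ) : Prop :=
  ∃ a₁ b₁ c₁ a₂ b₂ c₂ : ℕ, IsABCTriple a₁ b₁ c₁ ∧ rad a₁ b₁ c₁ ≤ R₁ ∧ IsABCTriple a₂ b₂ c₂ ∧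
    rad a₂ b₂ c₂ ≤ R₂ ∧ (c : ℝ) ≤ K * Real.exp (Real.log ((R₁ : ℝ) * R₂) ^ θ) * c₁ * c₂

/-- The crux RESTRICTED to a regime `Q` of (split, triple). `CruxOn (fun _ _ _ _ _ => True)` is the crux
(`cruxOn_univ_iff`). -/
def CruxOn (Q : ℕ → ℕ → ℕ → ℕ → ℕ → Prop) : Prop :=
  ∃ θ : ℝ, θ < 1 ∧ ∃ K : ℝ, 0 < K ∧ ∃ R₀ : ℕ, ∀ R₁ R₂ : ℕ, R₀ ≤ R₁ → R₀ ≤ R₂ → ∀ a b c : ℕ,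
    IsABCTriple a b c → rad a b c ≤ R₁ * R₂ → Q R₁ R₂ a b c → Shadowed θ K R₁ R₂ a b c

/-- Read-back: the unrestricted `CruxOn` is literally the route decl. [folklore] -/
theorem cruxOn_univ_iff : CruxOn (fun _ _ _ _ _ => True) ↔ ScaleSubmultiplicativity := by
  unfold CruxOn Shadowed ScaleSubmultiplicativity
  constructor
  · rintro ⟨θ, hθ, K, hK, R₀, h⟩
    exact ⟨θ, hθ, K, hK, R₀, fun R₁ R₂ h₁ h₂ a b c ht hr => h R₁ R₂ h₁ h₂ a b c ht hr trivial⟩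
  · rintro ⟨θ, hθ, K, hK, R₀, h⟩
    exact ⟨θ, hθ, K, hK, R₀, fun R₁ R₂ h₁ h₂ a b c ht hr _ => h R₁ R₂ h₁ h₂ a b c ht hr⟩

/-! ## §T  Transfer certificates -/

/-- The pointwise sub-power slack (hypothesis of the support item `SubmultOfRST`, stmt-ABC-10340):
`∃ τ < 1 ∃ A ∀ T, c < rad · exp(A (log rad)^τ)`. -/
def SubPower : Prop :=
  ∃ τ : ℝ, τ < 1 ∧ ∃ A : ℝ, ∀ a b c : ℕ, IsABCTriple a b c →
    (c : ℝ) < ((rad a b c : ℕ) : ℝ) * Real.exp (A * Real.log ((rad a b c : ℕ) : ℝ) ^ τ)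

/-- The sibling's step, transferred: pointwise bound + universal witnesses ⟹ crux — LANDED (stmt-ABC-10340). -/
example : SubPower → ScaleSubmultiplicativity := fun h => submultOfRST_proof h

/-- … and the pointwise input implies the SUMMIT (so a line through it is a costume). -/
example : SubPower → _root_.ABC := fun h => Target.abc_of_subPowerSlack h

/-- The only named hypothesis known to give the crux: RST Conjecture A, upper half (landed bridge). -/
example : Literature.Barriers.ABC.RSTConjectureAUpper → ScaleSubmultiplicativity :=
  SubmultOfRST.scaleSubmultiplicativity_of_rstConjectureAUpper

/-- The sibling's pointwise theorem itself (Mason–Stothers, Mathlib): the engine is the Wronskian /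
derivative, cf. `Literature.Barriers.ABC.NoArithmeticDerivative`. -/
example := @Polynomial.abc

/-! ## §S  Strengthenings (typed; none claimed) -/

/-- S2. abc with a constant of polynomial RATE in `1/ε`: `log C(ε) ≤ B ε^{-κ}` on `0 < ε ≤ 1`. Summit-plus. -/
def RateABC (κ B : ℝ) : Prop :=
  ∀ ε : ℝ, 0 < ε → ε ≤ 1 → ∀ a b c : ℕ, IsABCTriple a b c →
    (c : ℝ) < Real.exp (B * ε ^ (-κ)) * ((rad a b c : ℕ) : ℝ) ^ (1 + ε)

/-- Elementary real analysis (choose `ε := (log rad)^{-1/(κ+1)}`, giving `τ = κ/(κ+1)`); recorded as a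
statement only (BarrierNotesIdeator3 A2). -/
def RateABCGivesSubPower : Prop := ∀ κ B : ℝ, 0 < κ → RateABC κ B → SubPower

/-- S3. MONOTONE RECORD QUALITY (BarrierNotes-r1-k1 §7(b)), G-free: the best `log c / log R` over
`rad ≤ R` is quasi-non-increasing in the scale. Implies the crux (two lines in G-form); collapses onto the
pointwise envelope exactly as the crux does. -/
def MonotoneRecordQuality : Prop :=
  ∃ θ : ℝ, θ < 1 ∧ ∃ C : ℝ, ∃ R₀ : ℕ, ∀ R R' : ℕ, R₀ ≤ R → R ≤ R' →
    ∀ a' b' c' : ℕ, IsABCTriple a' b' c' → rad a' b' c' ≤ R' →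
    ∃ a b c : ℕ, IsABCTriple a b c ∧ rad a b c ≤ R ∧
      Real.log c' / Real.log R' ≤ Real.log c / Real.log R + C * Real.log R ^ (θ - 1)

/-- S4. PROPORTIONAL SHADOWS / TRACKING (BarrierNotesIdeator3 A11), G-free: below every triple, at every
scale `R ≤ rad`, a triple of proportional logarithmic height up to sub-power loss. Strictly stronger than the
crux in logic; no mechanism at desert records (A5(iii)). -/
def ProportionalShadows : Prop :=
  ∃ θ : ℝ, θ < 1 ∧ ∃ B : ℝ, ∃ R₀ : ℕ, ∀ a b c : ℕ, IsABCTriple a b c →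
    ∀ R : ℕ, R₀ ≤ R → R ≤ rad a b c → ∃ a' b' c' : ℕ, IsABCTriple a' b' c' ∧ rad a' b' c' ≤ R ∧
      Real.log R / Real.log ((rad a b c : ℕ) : ℝ) * Real.log c
        - Real.log ((rad a b c : ℕ) : ℝ) ^ θ - B ≤ Real.log c'

/-! ## §D  Decomposition: the generic regime split and two typed instances -/

/-- **Regime split.** The crux on a regime `Q` and on its complement give the crux BY NAME
(`θ := max`, `K := max`, `R₀ := max … 2`; relaxation by the landed `ScaleSubmultiplicativity.bound_mono`). [folklore] -/
theorem scaleSubmultiplicativity_of_split (Q : ℕ → ℕ → ℕ → ℕ → ℕ → Prop)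
    (h₁ : CruxOn Q) (h₂ : CruxOn (fun R₁ R₂ a b c => ¬ Q R₁ R₂ a b c)) :
    ScaleSubmultiplicativity := by
  obtain ⟨θ₁, hθ₁, K₁, hK₁, S₁, H₁⟩ := h₁
  obtain ⟨θ₂, hθ₂, K₂, hK₂, S₂, H₂⟩ := h₂
  refine ⟨max θ₁ θ₂, max_lt hθ₁ hθ₂, max K₁ K₂, lt_max_of_lt_left hK₁, max (max S₁ S₂) 2, ?_⟩
  intro R₁ R₂ hR₁ hR₂ a b c habc hrad
  have hS₁R₁ : S₁ ≤ R₁ := le_trans (le_trans (le_max_left _ _) (le_max_left _ _)) hR₁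
  have hS₁R₂ : S₁ ≤ R₂ := le_trans (le_trans (le_max_left _ _) (le_max_left _ _)) hR₂
  have hS₂R₁ : S₂ ≤ R₁ := le_trans (le_trans (le_max_right _ _) (le_max_left _ _)) hR₁
  have hS₂R₂ : S₂ ≤ R₂ := le_trans (le_trans (le_max_right _ _) (le_max_left _ _)) hR₂
  have h3 : 3 ≤ R₁ * R₂ :=
    calc 3 ≤ 2 * 2 := by norm_num
      _ ≤ R₁ * R₂ := Nat.mul_le_mul (le_trans (le_max_right _ _) hR₁) (le_trans (le_max_right _ _) hR₂)
  by_cases hQ : Q R₁ R₂ a b c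
  · obtain ⟨a₁, b₁, c₁, a₂, b₂, c₂, t₁, r₁, t₂, r₂, hle⟩ := H₁ R₁ R₂ hS₁R₁ hS₁R₂ a b c habc hrad hQ
    exact ⟨a₁, b₁, c₁, a₂, b₂, c₂, t₁, r₁, t₂, r₂,
      ScaleSubmultiplicativity.bound_mono (le_max_left _ _) (le_max_left _ _) hK₁.le h3 hle⟩
  · obtain ⟨a₁, b₁, c₁, a₂, b₂, c₂, t₁, r₁, t₂, r₂, hle⟩ := H₂ R₁ R₂ hS₂R₁ hS₂R₂ a b c habc hrad hQ
    exact ⟨a₁, b₁, c₁, a₂, b₂, c₂, t₁, r₁, t₂, r₂,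
      ScaleSubmultiplicativity.bound_mono (le_max_right _ _) (le_max_right _ _) hK₂.le h3 hle⟩

/-! ### D4 — depth in scale -/

/-- Regime D4: the triple sits at depth `≥ 2` inside the scale: `rad(abc)² ≤ R₁R₂`. -/
def DeepInScale (R₁ R₂ a b c : ℕ) : Prop := rad a b c ^ 2 ≤ R₁ * R₂

/-- Sub₁ of D4: the crux for triples deep in the scale. -/
def QuadraticDepthSubmult : Prop := CruxOn DeepInScale

/-- Sub₂ of D4: the crux for SHALLOW triples, `R₁R₂ < rad²` (this half contains `rad = R₁R₂`: the core). -/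
def ShallowSubmult : Prop := CruxOn (fun R₁ R₂ a b c => ¬ DeepInScale R₁ R₂ a b c)

/-- abc with the FIXED exponent `2` and some constant (implied by ABC with `ε = 1`; Granville–Tucker's
`WeakABCConjecture : c < rad²` is the `K = 1` form; open, beyond `Literature.Barriers.ABC.BakerMethodBounds`). -/
def FixedExponentTwoABC : Prop :=
  ∃ K : ℝ, 0 < K ∧ ∀ a b c : ℕ, IsABCTriple a b c → (c : ℝ) ≤ K * ((rad a b c : ℕ) : ℝ) ^ (2 : ℕ)

/-- `c < rad²` (abc.S03, in tree as a conjecture) gives `FixedExponentTwoABC` with `K = 1`. [folklore] -/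
theorem fixedExponentTwoABC_of_weakABC (h : WeakABCConjecture) : FixedExponentTwoABC := by
  refine ⟨1, one_pos, fun a b c ht => ?_⟩
  rw [one_mul]
  exact_mod_cast (h a b c ht).le

/-- **D4 glue**: Sub₁ ∧ Sub₂ ⟹ crux. [folklore] -/
theorem scaleSubmultiplicativity_of_depthSplit (h₁ : QuadraticDepthSubmult) (h₂ : ShallowSubmult) :
    ScaleSubmultiplicativity :=
  scaleSubmultiplicativity_of_split DeepInScale h₁ h₂

/-- **Sub₁ of D4 is below fixed-exponent abc**: `c ≤ K rad²` and `rad² ≤ R₁R₂ < 16 c₁c₂` (dyadic witnesses,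
`SubmultOfRST.exists_triple_at_scale`) give the crux inequality with `θ = 0`, constant `16K`, `R₀ = 4`. [folklore] -/
theorem quadraticDepthSubmult_of_fixedExponentTwo (h : FixedExponentTwoABC) : QuadraticDepthSubmult := by
  obtain ⟨K, hK, hpt⟩ := h
  refine ⟨0, zero_lt_one, 16 * K, by positivity, 4, ?_⟩
  intro R₁ R₂ hR₁ hR₂ a b c habc _hrad hdeep
  obtain ⟨a₁, b₁, c₁, t₁, r₁, hc₁⟩ := SubmultOfRST.exists_triple_at_scale hR₁
  obtain ⟨a₂, b₂, c₂, t₂, r₂, hc₂⟩ := SubmultOfRST.exists_triple_at_scale hR₂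
  refine ⟨a₁, b₁, c₁, a₂, b₂, c₂, t₁, r₁, t₂, r₂, ?_⟩
  have hP16 : R₁ * R₂ < 16 * (c₁ * c₂) :=
    calc R₁ * R₂ < (4 * c₁) * (4 * c₂) := Nat.mul_lt_mul'' hc₁ hc₂
      _ = 16 * (c₁ * c₂) := by ring
  have hdeepR : ((rad a b c : ℕ) : ℝ) ^ (2 : ℕ) ≤ (R₁ : ℝ) * R₂ := by
    unfold DeepInScale at hdeep; exact_mod_cast hdeep
  have hP16r : (R₁ : ℝ) * R₂ ≤ 16 * ((c₁ : ℝ) * c₂) := by exact_mod_cast hP16.le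
  have hexp1 : (1 : ℝ) ≤ Real.exp (Real.log ((R₁ : ℝ) * R₂) ^ (0 : ℝ)) := by
    rw [Real.rpow_zero]; exact Real.one_le_exp zero_le_one
  have h16K : (0 : ℝ) ≤ 16 * K := by positivity
  have hc₁0 : (0 : ℝ) ≤ (c₁ : ℝ) := Nat.cast_nonneg _
  have hc₂0 : (0 : ℝ) ≤ (c₂ : ℝ) := Nat.cast_nonneg _
  calc (c : ℝ) ≤ K * ((rad a b c : ℕ) : ℝ) ^ (2 : ℕ) := hpt a b c habc
    _ ≤ K * ((R₁ : ℝ) * R₂) := mul_le_mul_of_nonneg_left hdeepR hK.le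
    _ ≤ K * (16 * ((c₁ : ℝ) * c₂)) := mul_le_mul_of_nonneg_left hP16r hK.le
    _ = 16 * K * 1 * c₁ * c₂ := by ring
    _ ≤ 16 * K * Real.exp (Real.log ((R₁ : ℝ) * R₂) ^ (0 : ℝ)) * c₁ * c₂ :=
        mul_le_mul_of_nonneg_right
          (mul_le_mul_of_nonneg_right (mul_le_mul_of_nonneg_left hexp1 h16K) hc₁0) hc₂0

/-- So the DEEP half of D4 sits below Granville–Tucker's `c < rad²`. [folklore] -/
theorem quadraticDepthSubmult_of_weakABC (h : WeakABCConjecture) : QuadraticDepthSubmult :=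
  quadraticDepthSubmult_of_fixedExponentTwo (fixedExponentTwoABC_of_weakABC h)

/-! ### D5 — split shape -/

/-- Regime D5: the split is balanced up to squares (each scale at most the square of the other). -/
def BalancedSplit (R₁ R₂ _a _b _c : ℕ) : Prop := R₁ ≤ R₂ ^ 2 ∧ R₂ ≤ R₁ ^ 2

/-- Sub₁ of D5: the crux at balanced splits only (the Assembly's doublings live here). -/
def BalancedSubmult : Prop := CruxOn BalancedSplit

/-- Sub₂ of D5: the crux at lopsided splits ("local non-jumping" `G(R₀R) ≤ K s G(R₀)G(R)` lives here). -/
def LopsidedSubmult : Prop := CruxOn (fun R₁ R₂ a b c => ¬ BalancedSplit R₁ R₂ a b c)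

/-- **D5 glue**. [folklore] -/
theorem scaleSubmultiplicativity_of_shapeSplit (h₁ : BalancedSubmult) (h₂ : LopsidedSubmult) :
    ScaleSubmultiplicativity :=
  scaleSubmultiplicativity_of_split BalancedSplit h₁ h₂

/-! ### D1 (for the record) — the landed arithmetic split (P) ∧ (W) ⟹ crux is
`ScaleSubmultiplicativity.of_primitiveEnvelope_of_powerShapeSubmult` (p97123). -/
example := @ScaleSubmultiplicativity.of_primitiveEnvelope_of_powerShapeSubmult

/-! ## §N  Negation: what a refutation must certify at one split -/

/-- **Refutation template.** To violate the crux inequality at a split `(R₁, R₂)` with parameters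
`(θ, K)` one needs CERTIFIED POVERTY of both scales (upper bounds `Gᵢ` for every triple of radical `≤ Rᵢ`
— good-scale certification, the content of crux `SparseGoodScales`) AND a triple of radical `≤ R₁R₂` beating
`K · exp((log R₁R₂)^θ) · G₁G₂`.  Finite tables give the second at small scales only; nothing gives the first
beyond `rad ≤ 10⁷`. [folklore] -/
theorem not_shadowed_of_poor {θ K : ℝ} {R₁ R₂ a b c : ℕ} (G₁ G₂ : ℝ) (hK : 0 ≤ K)
    (hG₁ : ∀ a₁ b₁ c₁ : ℕ, IsABCTriple a₁ b₁ c₁ → rad a₁ b₁ c₁ ≤ R₁ → (c₁ : ℝ) ≤ G₁)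
    (hG₂ : ∀ a₂ b₂ c₂ : ℕ, IsABCTriple a₂ b₂ c₂ → rad a₂ b₂ c₂ ≤ R₂ → (c₂ : ℝ) ≤ G₂)
    (hbeat : K * Real.exp (Real.log ((R₁ : ℝ) * R₂) ^ θ) * G₁ * G₂ < c) :
    ¬ Shadowed θ K R₁ R₂ a b c := by
  rintro ⟨a₁, b₁, c₁, a₂, b₂, c₂, t₁, r₁, t₂, r₂, hle⟩
  have h₁ := hG₁ a₁ b₁ c₁ t₁ r₁
  have h₂ := hG₂ a₂ b₂ c₂ t₂ r₂
  have hc₁ : (0 : ℝ) ≤ c₁ := Nat.cast_nonneg _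
  have hc₂ : (0 : ℝ) ≤ c₂ := Nat.cast_nonneg _
  have hs : 0 ≤ K * Real.exp (Real.log ((R₁ : ℝ) * R₂) ^ θ) := mul_nonneg hK (Real.exp_pos _).le
  have hG₁0 : 0 ≤ G₁ := hc₁.trans h₁
  have hmono : K * Real.exp (Real.log ((R₁ : ℝ) * R₂) ^ θ) * c₁ * c₂
      ≤ K * Real.exp (Real.log ((R₁ : ℝ) * R₂) ^ θ) * G₁ * G₂ :=
    mul_le_mul (mul_le_mul_of_nonneg_left h₁ hs) h₂ hc₂ (mul_nonneg hs hG₁0)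
  linarith

/-- Toy-family data point (BarrierNotes-r1-k1 §4, the binary-√2 family): `7 + 181² = 2¹⁵` is an abc triple;
`rad = 2·7·181 = 2534`, `c/rad = 12.93`, quality `1.3266` (the zero-run of length 5 after position 7 in binary √2). -/
example : IsABCTriple 7 (181 ^ 2) (2 ^ 15) := ⟨by norm_num, by norm_num, by norm_num, by norm_num⟩

end Summit.ABC.ABC.Cruxes.ScaleSubmultiplicativity.Strategist
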